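import Literature.AnabelianGeometry.AbsoluteAnabelian.AbsTopIProp23GFGSurfaceModelExtension
import Literature.AnabelianGeometry.AbsoluteAnabelian.AbsTopIDef21GFGQuotientExistence
import Literature.AnabelianGeometry.AbsoluteAnabelian.AbsAnabStarConditionSplitCompletion
import Literature.AnabelianGeometry.AbsoluteAnabelian.AbsTopIThm26SplitModelInstances
import Literature.AnabelianGeometry.SemiGraphs.ProSigmaCompletionModels
import Literature.AnabelianGeometry.SemiGraphs.ProSigmaCompletionTFG
import Summits.ABC.IUTFork.AbsTopIThm26iiiOfSigmaStarHolds
import HarnessLib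

/-!
# [AbsTopI] Prop 2.3 (i) at the Def 2.1 (i) GFG SURFACE carrier and Thm 2.6 (iii) at the split model:
# the two closers of record with ZERO residual binder (abc-iut K4 re-close, nodes AbsTopI:Prop2.3(i) /
# AbsTopI:Thm2.6(iii))

S. Mochizuki, *Topics in Absolute Anabelian Geometry I: Generalities* (2012) [AbsTopI] (lit key
`paper:url-11ac98ba15fc`), Def 2.1 (i) p. 17, Prop 2.3 (i) p. 19, Thm 2.6 (iii) p. 22; [AbsAnab]
Lemma 1.1.4 (ii) p. 7 (condition (∗), the splitting over an open subgroup); [SemiAnbd] Ex. 2.10 p. 31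
(pro-`Σ` completions).

Cell `abc-iut`, seat abc-iut-c312-2 (L4 lineage; K-census owner).  PROOF-ONLY file (no definition,
no named fact).  The cone nodes AbsTopI:Prop2.3(i) and AbsTopI:Thm2.6(iii) are discharged of record
by closers that BIND, as hypotheses on abstract data, FACT-LIST rows whose universal closure is
refuted as typed (F-2528 `IsProSigmaCompletion`; F-0011 `SplitsOverOpenSubgroup`, F-0012
`StarCondition`, F-0240 `GeomTFG`).  abc-iut-L4-lead gen 9 booked both rows «INHABITED … RECLOSED
0/n — zero-binder sibling … not written» (HOME
`staging/L4/abc-iut-L4-lead/gen9/K4-L4lead-RECLOSABLE-INHABITED.tsv`).  This file WRITES the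
zero-binder siblings, feeding every such binder by an ACCEPTED producer of the tree:

* `FundamentalExtension.exists_gfg_carrier` — for every profinite `P`, open normal `U ⊴ P`, `Σ` and
  prime `p`: an extension `E` with MLF base data `G = G_{ℚ_p}` and a Def 2.1 (i) presentation
  `π : P ↠ Δ_E` (`Ker π = K_Σ(U) ≤ U`, `π|_U` the maximal pro-`Σ` quotient of `U`).  This is
  abc-iut-w5-d206's `exists_gfg_affine_carrier` (`AbsTopIThm26GFGCarrierInstances.lean`) with its
  unused free-group datum removed (the construction never used it), so that it serves the PROPER
  case as well.  HONEST LABEL: the PRODUCT `(P ⧸ K_Σ(U)) × G_{ℚ_p}` (trivial outer action), a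
  group-theoretic carrier of the Def 2.1 (i) `Δ`, not the arithmetic fundamental group of a curve.
* `FundamentalExtension.exists_gfg_surface_carrier_geomSlimElastic` — the closer of record
  `geomSlimElastic_gfg` (p440186 lineage) APPLIED at that carrier for `Γ ≅ S_g`, `g ≥ 2`, any
  pro-`Σ′` completion `j : Γ → P`: `Δ_E` slim and elastic with NO residual binder beyond the
  Def 2.1 (i) data; `exists_gfg_surface_model_geomSlimElastic` — the fully explicit inhabitant
  `Γ = S_g`, `P` a pro-`Σ′` completion of `S_g` (`IsProSigmaCompletion.exists_isProSigmaCompletion`),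
  `U = P`: Prop 2.2 + Prop 2.3 (i)(ii) hold there (`prop22_prop23_gfg_mlf`), zero hypotheses.
* `FundamentalExtension.thm26iii_split_profiniteCompletion_freeGroup'` / `thm26iii_holds` — the
  closer of record `thm26iii_primes_of_starCondition` (p448752) at the split model
  `F̂_n × G_K ↠ G_K` (`K/ℚ_p` finite; closed instance `K = ℚ_p`) with ALL FOUR inputs fed by name:
  F-0240 by `IsProSigmaCompletion.isTopologicallyFinitelyGenerated_of_fg` at
  `isProSigmaCompletion_toCompletion` (pushed along `F̂_n ↠ Δ`, `exists_surjective_toGeom_split`), F-0011 by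
  `splitsOverOpenSubgroup_holds`, F-0012 by `starCondition_holds`, and "`G_K` topologically finitely
  generated" ([NSW] 7.5.10) by `isTopologicallyFinitelyGenerated_absoluteGaloisGroup_padic`
  (Summits-side, whence this file's location); `exists_thm26iii_geom_ne_bot` — with `Δ ≠ 1`.
  HONEST LABEL: split model, trivial outer action — a joint satisfiability witness of the typed
  hypotheses, not the extension of a hyperbolic curve (same status as the tree's `thm26ii_holds`).

Nothing here bears on [IUTchIII] Cor. 3.12 or asserts anything about abc; no side is taken; typed ≠
proved elsewhere; re-closed-as-typed ≠ proved-in-print.  Theorems only; axioms standard.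
-/

noncomputable section

open Topology

namespace Literature.AnabelianGeometry.AbsoluteAnabelian

namespace FundamentalExtension

open Field
open Literature.IUT.HodgeTheaters (profiniteCompletion toCompletion)
open Literature.AnabelianGeometry.SemiGraphs.PSCDatum (IsMaxProSigmaQuotient)
open Literature.AnabelianGeometry.SemiGraphs.SemiGraphOfAnabelioids
open Literature.AnabelianGeometry.SemiGraphs.SemiGraphOfAnabelioids.IsProSigmaCompletion
open Literature.GroupTheory.ProfiniteSubquotients
open Literature.Topology.FourManifolds (SurfaceGroup)

/-! ### The Def 2.1 (i) carrier over an arbitrary profinite `P` -/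

/-- Transport of `IsMaxProSigmaQuotient` along an isomorphism of topological groups on the TARGET
(abc-iut-w5-d206's private lemma of `AbsTopIThm26GFGCarrierInstances.lean`, restated for use here).
[cite: MochizukiAbsTopI2012, Def 2.1 (i) p.17] -/
theorem isMaxProSigmaQuotient_of_target_continuousMulEquiv' {S : Set ℕ} {A Q Q' : Type}
    [Group A] [TopologicalSpace A] [Group Q] [TopologicalSpace Q] [Group Q'] [TopologicalSpace Q']
    {f : A →* Q} (hf : IsMaxProSigmaQuotient S f) (e : Q ≃ₜ* Q') {f' : A →* Q'}
    (h : ∀ x, f' x = e (f x)) : IsMaxProSigmaQuotient S f' := by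
  have hfun : (f' : A → Q') = fun x => e (f x) := funext h
  refine ⟨?_, ?_, hf.proSigma.of_continuousMulEquiv e, ?_⟩
  · rw [hfun]; exact e.continuous.comp hf.continuous
  · intro y
    obtain ⟨x, hx⟩ := hf.surjective (e.symm y)
    exact ⟨x, by rw [h, hx, ContinuousMulEquiv.apply_symm_apply]⟩
  · intro N hN hNo hNi
    have hk : f'.ker = f.ker := by
      ext x
      rw [MonoidHom.mem_ker, MonoidHom.mem_ker, h, ← map_one e, e.injective.eq_iff]
    rw [hk]
    exact hf.ker_le N hN hNo hNi

/-- **The Def 2.1 (i) GFG carrier over ANY profinite `P`**: for every prime `p`, every profinite group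
`P`, every open normal `U ⊴ P` and every `Σ`, there is an extension `E : FundamentalExtension` with
MLF base data (`G = G_{ℚ_p}`) together with a Def 2.1 (i) presentation `π : P ↠ Δ_E` (`π` continuous
surjective, `Ker π = K_Σ(U) ≤ U`, `π|_U` the maximal pro-`Σ` quotient of `U`).  HONEST LABEL:
`Π := (P ⧸ K_Σ(U)) × G_{ℚ_p}`, the PRODUCT (trivial outer Galois action) — a group-theoretic carrier
of the Def 2.1 (i) `Δ`, not the arithmetic fundamental group of a curve over `ℚ_p`.
[cite: MochizukiAbsTopI2012, Def 2.1 (i) p.17] -/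
theorem exists_gfg_carrier (p : ℕ) [Fact p.Prime] (Sigma : Set ℕ)
    {P : Type} [Group P] [TopologicalSpace P] [IsTopologicalGroup P] [CompactSpace P]
    [TotallyDisconnectedSpace P] (U : Subgroup P) [U.Normal] (hUo : IsOpen (U : Set P)) :
    ∃ (E : FundamentalExtension.{0}) (_ : E.MLFBase) (π : P →* E.geom), Continuous π ∧
      Function.Surjective π ∧ π.ker ≤ U ∧ IsMaxProSigmaQuotient Sigma (π.subgroupMap U) := by
  classical
  obtain ⟨K, hKn, hKc, hKU, hmax⟩ := GFGSurfaceModel.exists_gfgQuotient Sigma U hUo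
  haveI := hKn
  haveI : IsClosed ((K : Subgroup P) : Set P) := hKc
  haveI : TotallyDisconnectedSpace (P ⧸ K) := totallyDisconnectedSpace_quotient K hKc
  let E : FundamentalExtension.{0} :=
    { arith := ProfiniteGrp.of ((P ⧸ K) × absoluteGaloisGroup ℚ_[p])
      gal := ProfiniteGrp.of (absoluteGaloisGroup ℚ_[p])
      aug := ⟨MonoidHom.snd (P ⧸ K) (absoluteGaloisGroup ℚ_[p]), continuous_snd⟩
      aug_surjective := fun y => ⟨(1, y), rfl⟩ }
  let B : E.MLFBase := { p := p, K := ℚ_[p], galIso := ContinuousMulEquiv.refl _ }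
  -- `Δ_E = (P ⧸ K) × 1`
  have hmem : ∀ x : P ⧸ K, ((x, (1 : absoluteGaloisGroup ℚ_[p])) : E.arith) ∈ E.geom := fun x => by
    rw [mem_geom]; rfl
  have hsnd : ∀ z : E.geom, (z : E.arith).2 = 1 := fun z => (mem_geom E).mp z.2
  let ι : (P ⧸ K) →* E.geom :=
    { toFun := fun x => ⟨(x, 1), hmem x⟩
      map_one' := rfl
      map_mul' := fun a b => Subtype.ext (Prod.ext rfl (mul_one _).symm) }
  -- the first projection `Δ_E ≅ P ⧸ K`, an isomorphism of topological groups with inverse `ι`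
  let eΔ : E.geom ≃ₜ* (P ⧸ K) :=
    { toFun := fun z => (z : E.arith).1
      invFun := ι
      left_inv := fun z => Subtype.ext (Prod.ext rfl (hsnd z).symm)
      right_inv := fun _ => rfl
      map_mul' := fun _ _ => rfl
      continuous_toFun := continuous_fst.comp continuous_subtype_val
      continuous_invFun := (continuous_id.prodMk continuous_const).subtype_mk _ }
  let π : P →* E.geom := ι.comp (QuotientGroup.mk' K)
  have hπc : Continuous π := eΔ.symm.continuous.comp QuotientGroup.continuous_mk
  have hπs : Function.Surjective π := eΔ.symm.surjective.comp (QuotientGroup.mk'_surjective K)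
  have hπker : π.ker = K := by
    ext x
    rw [MonoidHom.mem_ker, ← QuotientGroup.eq_one_iff x, show π x = eΔ.symm (QuotientGroup.mk' K x) from rfl,
      ← map_one eΔ.symm, eΔ.symm.injective.eq_iff]
    rfl
  -- the restriction `U.map (mk' K) ⥲ U.map π` of `eΔ.symm`
  have hfwd : ∀ y : P ⧸ K, y ∈ U.map (QuotientGroup.mk' K) → ι y ∈ U.map π := by
    rintro y ⟨u, hu, rfl⟩
    exact ⟨u, hu, rfl⟩
  have hbwd : ∀ z : E.geom, z ∈ U.map π → (z : E.arith).1 ∈ U.map (QuotientGroup.mk' K) := by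
    rintro z ⟨u, hu, rfl⟩
    exact ⟨u, hu, rfl⟩
  let eU : (U.map (QuotientGroup.mk' K)) ≃ₜ* (U.map π) :=
    { toFun := fun y => ⟨ι y, hfwd y y.2⟩
      invFun := fun z => ⟨((z : E.geom) : E.arith).1, hbwd z z.2⟩
      left_inv := fun _ => rfl
      right_inv := fun z => Subtype.ext (Subtype.ext (Prod.ext rfl (hsnd z).symm))
      map_mul' := fun _ _ => Subtype.ext (Subtype.ext (Prod.ext rfl (mul_one _).symm))
      continuous_toFun := (eΔ.symm.continuous.comp continuous_subtype_val).subtype_mk _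
      continuous_invFun :=
        (continuous_fst.comp (continuous_subtype_val.comp continuous_subtype_val)).subtype_mk _ }
  have hmaxπ : IsMaxProSigmaQuotient Sigma (π.subgroupMap U) :=
    isMaxProSigmaQuotient_of_target_continuousMulEquiv' hmax eU fun _ => rfl
  exact ⟨E, B, π, hπc, hπs, (le_of_eq hπker).trans hKU, hmaxπ⟩

/-! ### AbsTopI:Prop2.3(i) — the closer of record at the GFG SURFACE carrier, zero residual binder -/

/-- **[AbsTopI] Prop 2.3 (i) WITNESSED at a Def 2.1 (i) GFG surface carrier (PROPER case)**: for
`Γ ≅ S_g` (`g ≥ 2`), ANY pro-`Σ′` completion `j : Γ → P`, any open normal `U ⊴ P`, `Σ ⊆ Σ′`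
containing a prime, and every prime `p`, the extension `E` of `exists_gfg_carrier` (MLF base
`G_{ℚ_p}`, `Δ_E = P ⧸ K_Σ(U)`) has `Δ_E` slim and elastic — the node's closer of record
`geomSlimElastic_gfg` with NO residual hypothesis beyond the Def 2.1 (i) DATA.
[cite: MochizukiAbsTopI2012, Prop 2.3 (i) p.19] -/
theorem exists_gfg_surface_carrier_geomSlimElastic (p : ℕ) [Fact p.Prime] {Sigma Sigma' : Set ℕ}
    (hSS : Sigma ⊆ Sigma') (hS : ∃ ℓ ∈ Sigma, ℓ.Prime) {Γ : Type} [Group Γ] {g : ℕ} (hg : 2 ≤ g)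
    (e : Γ ≃* SurfaceGroup g) {P : Type} [Group P] [TopologicalSpace P] [IsTopologicalGroup P]
    [CompactSpace P] [TotallyDisconnectedSpace P] {j : Γ →* P} (hj : IsProSigmaCompletion Sigma' j)
    (U : Subgroup P) [U.Normal] (hUo : IsOpen (U : Set P)) :
    ∃ (E : FundamentalExtension.{0}) (_ : E.MLFBase) (π : P →* E.geom), Function.Surjective π ∧
      π.ker ≤ U ∧ IsMaxProSigmaQuotient Sigma (π.subgroupMap U) ∧ E.GeomSlimElastic := by
  obtain ⟨E, B, π, hπc, hπs, hker, hmax⟩ := exists_gfg_carrier p Sigma U hUo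
  exact ⟨E, B, π, hπs, hker, hmax, geomSlimElastic_gfg hSS hS hg e hj hUo hπc hπs hker hmax⟩

/-- **[AbsTopI] Prop 2.2 + Prop 2.3 (i)(ii) WITNESSED at a GFG surface carrier with MLF base**: same
data as `exists_gfg_surface_carrier_geomSlimElastic`, with `Σ` a set of primes; all three node
predicates hold at `E` (`prop22_prop23_gfg_mlf`). [cite: MochizukiAbsTopI2012, Prop 2.3 p.19] -/
theorem exists_gfg_surface_carrier_prop22_prop23 (p : ℕ) [Fact p.Prime] {Sigma Sigma' : Set ℕ}
    (hSS : Sigma ⊆ Sigma') (hS : ∃ ℓ ∈ Sigma, ℓ.Prime) (hSp : ∀ q ∈ Sigma, q.Prime) {Γ : Type}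
    [Group Γ] {g : ℕ} (hg : 2 ≤ g) (e : Γ ≃* SurfaceGroup g) {P : Type} [Group P]
    [TopologicalSpace P] [IsTopologicalGroup P] [CompactSpace P] [TotallyDisconnectedSpace P]
    {j : Γ →* P} (hj : IsProSigmaCompletion Sigma' j) (U : Subgroup P) [U.Normal]
    (hUo : IsOpen (U : Set P)) :
    ∃ (E : FundamentalExtension.{0}) (_ : E.MLFBase) (π : P →* E.geom), Function.Surjective π ∧
      π.ker ≤ U ∧ IsMaxProSigmaQuotient Sigma (π.subgroupMap U) ∧
      E.GeomTFG ∧ E.GeomSlimElastic ∧ E.ArithSlimNotElastic := by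
  obtain ⟨E, B, π, hπc, hπs, hker, hmax⟩ := exists_gfg_carrier p Sigma U hUo
  exact ⟨E, B, π, hπs, hker, hmax, prop22_prop23_gfg_mlf B hSS hS hSp hg e hj hUo hπc hπs hker hmax⟩

/-- **A fully explicit inhabitant for AbsTopI:Prop2.3(i)**: `Γ = S_g` (`g ≥ 2`), `P` a pro-`Σ′`
completion of `S_g` (F-2528 fed by `IsProSigmaCompletion.exists_isProSigmaCompletion`), `U = P`,
base `G_{ℚ_p}` — an MLF-based extension whose `Δ` IS a (proper) Def 2.1 (i) GFG quotient and is
topologically finitely generated, slim and elastic, with `Π` slim and not elastic, EXISTS for every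
prime `p` and all `Σ ⊆ Σ′` with `Σ` a set of primes containing a prime.  Zero hypotheses.
[cite: MochizukiAbsTopI2012, Prop 2.3 (i) p.19] [cite: MochizukiSemiAnbd2006, Ex. 2.10 p.31] -/
theorem exists_gfg_surface_model_geomSlimElastic (p : ℕ) [Fact p.Prime] {g : ℕ} (hg : 2 ≤ g)
    (Sigma Sigma' : Set ℕ) (hSS : Sigma ⊆ Sigma') (hS : ∃ ℓ ∈ Sigma, ℓ.Prime)
    (hSp : ∀ q ∈ Sigma, q.Prime) :
    ∃ (E : FundamentalExtension.{0}) (_ : E.MLFBase),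
      E.GeomTFG ∧ E.GeomSlimElastic ∧ E.ArithSlimNotElastic := by
  classical
  obtain ⟨Q, j, hj⟩ := IsProSigmaCompletion.exists_isProSigmaCompletion (SurfaceGroup g) Sigma'
  obtain ⟨E, B, π, -, -, -, h⟩ :=
    exists_gfg_surface_carrier_prop22_prop23 p hSS hS hSp hg (MulEquiv.refl (SurfaceGroup g)) hj
      (⊤ : Subgroup Q) isOpen_univ
  exact ⟨E, B, h⟩

/-! ### AbsTopI:Thm2.6(iii) — the closer of record at the split model, zero residual binder -/

/-- **[AbsTopI] Thm 2.6 (iii) AS TYPED at the split model `F̂_n × G_K ↠ G_K`, UNCONDITIONAL**: for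
every `n`, every prime `p` and every finite `K/ℚ_p`, the extension `Π := F̂_n × G_K ↠ G_K` (`F̂_n`
Mathlib's profinite completion of the free group, a pro-`Σ` completion for `Σ = Primes`) with MLF
base datum `(p, K, refl)` satisfies the typed Thm 2.6 (iii) for `Σ = Primes` — the closer of record
`thm26iii_primes_of_starCondition` with its four inputs FED BY NAME: Prop 2.2 (`GeomTFG`, F-0240) by
`IsProSigmaCompletion.isTopologicallyFinitelyGenerated_of_fg` (along `F̂_n ↠ Δ`), the splitting (F-0011) by `splitsOverOpenSubgroup_holds`,
condition (∗) (F-0012) by `starCondition_holds`, and "`G_K` tfg" ([NSW] 7.5.10) by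
`isTopologicallyFinitelyGenerated_absoluteGaloisGroup_padic`.  HONEST LABEL: trivial outer action.
[cite: MochizukiAbsTopI2012, Thm 2.6 (iii) p.22] [cite: NeukirchSchmidtWingberg2008, Thm. 7.5.10] -/
theorem thm26iii_split_profiniteCompletion_freeGroup' (n p : ℕ) [Fact p.Prime] (K : Type) [Field K]
    [CharZero K] [Algebra ℚ_[p] K] [FiniteDimensional ℚ_[p] K] :
    (⟨ProfiniteGrp.of (profiniteCompletion (FreeGroup (Fin n)) × absoluteGaloisGroup K),
        absoluteGaloisGrp K,
        ContinuousMonoidHom.snd (profiniteCompletion (FreeGroup (Fin n))) (absoluteGaloisGroup K),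
        Prod.snd_surjective⟩ : FundamentalExtension.{0}).Thm26iii {q | q.Prime} := by
  let P : ProfiniteGrp.{0} := profiniteCompletion (FreeGroup (Fin n))
  let E : FundamentalExtension.{0} :=
    ⟨ProfiniteGrp.of (P × absoluteGaloisGroup K), absoluteGaloisGrp K,
      ContinuousMonoidHom.snd P (absoluteGaloisGroup K), Prod.snd_surjective⟩
  let B : E.MLFBase := { p := p, K := K, galIso := ContinuousMulEquiv.refl _ }
  -- Prop 2.2 (F-0240 `GeomTFG`): `F̂_n` is topologically finitely generated (a pro-`Σ` completion of
  -- the f.g. group `F_n`), hence so is its continuous image `Δ = F̂_n × 1`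
  obtain ⟨j, hj⟩ := exists_surjective_toGeom_split P K
  have hΔ : E.GeomTFG :=
    (IsProSigmaCompletion.isTopologicallyFinitelyGenerated_of_fg
      (IsProSigmaCompletion.isProSigmaCompletion_toCompletion (FreeGroup (Fin n)))).of_surjective j hj
  exact thm26iii_primes_of_starCondition' B hΔ (splitsOverOpenSubgroup_holds n K)
    (starCondition_holds n K)

/-- **`thm26iii_holds` — [AbsTopI] Thm 2.6 (iii) AS TYPED, closed instance, zero hypotheses**: the
split extension `F̂_n × G_{ℚ_p} ↠ G_{ℚ_p}` with MLF base datum `(p, ℚ_p, refl)` satisfies the typed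
Thm 2.6 (iii) for `Σ = Primes` (the regime of [IUTchI–III]).  HONEST LABEL: split model, trivial
outer action, not a curve's extension; re-closed-as-typed ≠ proved-in-print.
[cite: MochizukiAbsTopI2012, Thm 2.6 (iii) p.22] -/
theorem thm26iii_holds (n p : ℕ) [Fact p.Prime] :
    (⟨ProfiniteGrp.of (profiniteCompletion (FreeGroup (Fin n)) × absoluteGaloisGroup ℚ_[p]),
        absoluteGaloisGrp ℚ_[p],
        ContinuousMonoidHom.snd (profiniteCompletion (FreeGroup (Fin n))) (absoluteGaloisGroup ℚ_[p]),
        Prod.snd_surjective⟩ : FundamentalExtension.{0}).Thm26iii {q | q.Prime} :=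
  thm26iii_split_profiniteCompletion_freeGroup' n p ℚ_[p]

end FundamentalExtension

end Literature.AnabelianGeometry.AbsoluteAnabelian

namespace Summit.ABC.IUTFork

open Field Literature.AnabelianGeometry.AbsoluteAnabelian Literature.IUT.HodgeTheaters
open Literature.AnabelianGeometry.SemiGraphs.SemiGraphOfAnabelioids

/-- **An extension with MLF base data and NON-TRIVIAL `Δ` satisfying the typed [AbsTopI] Thm 2.6 (iii)
for `Σ = Primes`** — the split model `F̂_n × G_{ℚ_p} ↠ G_{ℚ_p}` with `n ≥ 1`: `Δ = F̂_n × 1 ≠ 1`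
because `δ¹_p(Π) = δ¹_p(G) + n > δ¹_p(G)` (an extension with `Δ = 1` has `Π ≅ G`); the binders of the
node's closer are JOINTLY satisfiable at a non-degenerate `Δ`. [cite: MochizukiAbsTopI2012, Thm 2.6 (iii) p.22] -/
theorem exists_thm26iii_geom_ne_bot (n p : ℕ) [Fact p.Prime] (hn : 1 ≤ n) :
    ∃ (E : FundamentalExtension.{0}) (_ : E.MLFBase),
      E.geom ≠ ⊥ ∧ E.Thm26iii {q | q.Prime} := by
  let P : ProfiniteGrp.{0} := profiniteCompletion (FreeGroup (Fin n))
  let Γ := absoluteGaloisGroup ℚ_[p]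
  let E : FundamentalExtension.{0} :=
    ⟨ProfiniteGrp.of (P × Γ), absoluteGaloisGrp ℚ_[p], ContinuousMonoidHom.snd P Γ,
      Prod.snd_surjective⟩
  let B : E.MLFBase := { p := p, K := ℚ_[p], galIso := ContinuousMulEquiv.refl _ }
  refine ⟨E, B, fun hΔ => ?_, FundamentalExtension.thm26iii_holds n p⟩
  -- if `Δ = 1` then `aug : Π → G` is a continuous bijection, so `δ¹_p(Π) ≤ δ¹_p(G)`
  have hinj : Function.Injective E.aug := (MonoidHom.ker_eq_bot_iff E.aug.toMonoidHom).mp hΔ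
  let e₀ : E.arith ≃ E.gal := Equiv.ofBijective E.aug ⟨hinj, E.aug_surjective⟩
  let eₜ : E.arith ≃ₜ E.gal := Continuous.homeoOfEquivCompactToT2 (f := e₀) (map_continuous E.aug)
  let e : E.arith ≃ₜ* E.gal := ContinuousMulEquiv.mk' eₜ fun x y => map_mul E.aug x y
  have hrank : freeProlRank E.arith p = freeProlRank E.gal p :=
    freeProlRank_eq_of_continuousMulEquiv e p
  -- but `δ¹_p(Π) = δ¹_p(G) + n` with `n ≥ 1` and `δ¹_p(G) = [ℚ_p : ℚ_p] + 1` finite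
  have hadd : freeProlRank E.arith p = freeProlRank E.gal p + n :=
    freeProlRank_prod_eq_add_of_isProSigmaCompletion_freeGroup
      (IsProSigmaCompletion.isProSigmaCompletion_toCompletion (FreeGroup (Fin n))) p
      (Fact.out : p.Prime)
  have hG : freeProlRank E.gal p = (Module.finrank ℚ_[p] ℚ_[p] + 1 : ℕ) :=
    (FundamentalExtension.freeProlRank_gal B).2
  rw [hrank, hG] at hadd
  have h : (Module.finrank ℚ_[p] ℚ_[p] + 1 : ℕ) = Module.finrank ℚ_[p] ℚ_[p] + 1 + n := by
    exact_mod_cast hadd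
  omega

end Summit.ABC.IUTFork

end
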